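import Mathlib
import HarnessLib

/-!
# The (column) Khatri–Rao product `B ⊙ C = [b₁ ⊗ c₁ | ⋯ | b_q ⊗ c_q]`
(Golub–Van Loan §12.3.3, §12.5.4; Kolda–Bader §2.6, §3)

Topic `LinearAlgebra/TensorNetworks`.  Golub–Van Loan, *Matrix Computations* (4th ed., 2013),
§12.3.3 "The Hadamard and Khatri-Rao Products" (held copy `book:golub2012-matrix-computations`,
PDF pp. 656–657): "There are two submatrices of `B ⊗ C` that are particularly important" — the
Hadamard product `B .* C` and the Khatri–Rao product, whose "particularly important instance …
based on column partitionings" is `[b₁ | ⋯ | b_n] ⊗_KR [c₁ | ⋯ | c_n] = [b₁ ⊗ c₁ | ⋯ | b_n ⊗ c_n]`;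
§12.5.4 "The CP Approximation Problem" (PDF pp. 682–684): the modal unfoldings of a CP tensor
`𝓧 = Σ_j λ_j f_j ∘ g_j ∘ h_j` are `𝓧₍₁₎ = F · diag(λ_j) · (H ⊙ G)ᵀ`, … (display before (12.5.16)),
and the ALS normal equations `((BᵀB) .* (CᵀC)) z = (B ⊙ C)ᵀ d` (12.5.20).  Kolda–Bader, *Tensor
Decompositions and Applications* (SIAM Rev. 2009), §2.6 (held preprint
`paper:doi-10-1137-07070111x`, pp. 7–8): the Khatri–Rao product is "the 'matching columnwise'
Kronecker product" `A ⊙ B = [a₁ ⊗ b₁ ⋯ a_K ⊗ b_K]`, "if `a` and `b` are vectors, then the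
Khatri–Rao and Kronecker products are identical", and the properties (2.2)
`A ⊙ B ⊙ C = (A ⊙ B) ⊙ C = A ⊙ (B ⊙ C)`, `(A ⊙ B)ᵀ(A ⊙ B) = AᵀA ∗ BᵀB`; §3 (p. 9): the
matricised CP model `X₍₁₎ ≈ A (C ⊙ B)ᵀ`, `X₍₂₎ ≈ B (C ⊙ A)ᵀ`, `X₍₃₎ ≈ C (B ⊙ A)ᵀ` (3.2) and the
frontal slices `X_k ≈ A D⁽ᵏ⁾ Bᵀ`, `D⁽ᵏ⁾ = diag(c_{k,:})`.  (Both held texts were read at these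
places.)

In Mathlib's pair indexing (`(B ⊗ₖ C) (i, j) (k, l) = B i k * C j l`, no linear orders) the column
Khatri–Rao product of `B : Matrix m q R` and `C : Matrix n q R` is
`khatriRao B C : Matrix (m × n) q R`, `(i, j), k ↦ B i k * C j k`.  This file records:
* `khatriRao_eq_submatrix_kronecker` — GVL §12.3.3: `B ⊙ C` is the column-submatrix `k ↦ (k, k)`
  of `B ⊗ₖ C`; `hadamard_eq_submatrix_kronecker`, `hadamard_eq_submatrix_khatriRao` — the Hadamard
  product is the further row-submatrix `i ↦ (i, i)`;
* `khatriRao_col` — column `k` is `b_k ⊗ c_k` (`= vec` of the rank-one matrix `b_k c_kᵀ`, read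
  transposed); `kronecker_eq_khatriRao_of_unique` — for one-column matrices the two products agree
  (Kolda–Bader);
* bilinearity (`add_khatriRao`, `khatriRao_add`, `smul_khatriRao`, `khatriRao_smul`,
  `zero_khatriRao`, `khatriRao_zero`) and the diagonal scalings `khatriRao_mul_diagonal`,
  `khatriRao_diagonal_mul_left` (CP weights may be absorbed in either factor);
* `khatriRao_assoc` — Kolda–Bader (2.2): associativity up to `Equiv.prodAssoc`;
* `khatriRao_transpose_mul_khatriRao` — `(B ⊙ C)ᵀ (B' ⊙ C') = (BᵀB') ⊙ₕ (CᵀC')` and its square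
  case `khatriRao_transpose_mul_self` — Kolda–Bader (2.2) / the GVL normal equations (12.5.20);
  the `ᴴ` version `khatriRao_conjTranspose_mul_khatriRao`;
* `kronecker_mul_khatriRao` — the mixed product `(A ⊗ₖ A') (B ⊙ C) = (A B) ⊙ (A' C)` (column
  `k`: `(A ⊗ A')(b_k ⊗ c_k) = A b_k ⊗ A' c_k`, GVL §1.3.6 mixed-product rule columnwise);
  `khatriRao_comm` — `C ⊙ B` is `B ⊙ C` with rows permuted by `Prod.swap` ((1.3.5) columnwise);
  `hadamard_gram_mulVec` — the ALS normal equations `((BᵀB) ∗ (CᵀC)) z = (B ⊙ C)ᵀ((B ⊙ C) z)`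
  (GVL (12.5.19)–(12.5.20));
* the CP unfolding: `mul_diagonal_mul_khatriRao_transpose_apply` —
  `(F · diag λ · (H ⊙ G)ᵀ) i (k, j) = Σ_r λ_r F i r G j r H k r` (GVL §12.5.4, Kolda–Bader (3.2)),
  `cp_frontal_slice` — fixing the third index gives `F · diag(λ_r H k r) · Gᵀ` (Kolda–Bader §3),
  and the vectorised two-factor case `khatriRao_mulVec : (B ⊙ C) *ᵥ d = vec (C · diag d · Bᵀ)`.

Not here: the pseudo-inverse formula `(A ⊙ B)† = ((AᵀA) ∗ (BᵀB))† (A ⊙ B)ᵀ` (Kolda–Bader (2.2))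
and k-rank / uniqueness statements.
-/

open Matrix
open scoped Kronecker

namespace Literature.LinearAlgebra.TensorNetworks

universe u

variable {R : Type u} {l m n p q : Type*}

/-! ## Definition and the submatrix-of-Kronecker description -/

section Def

variable [Mul R]

/-- The (column) Khatri–Rao product `B ⊙ C = [b₁ ⊗ c₁ | ⋯ | b_q ⊗ c_q]` in Mathlib's pair indexing:
`khatriRao B C (i, j) k = B i k * C j k`.
[cite: GolubVanLoan2013, §12.3.3] [cite: KoldaBader2009, §2.6] -/
def khatriRao (B : Matrix m q R) (C : Matrix n q R) : Matrix (m × n) q R :=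
  Matrix.of fun ij k => B ij.1 k * C ij.2 k

/-- Entry formula.  [cite: KoldaBader2009, §2.6] -/
@[simp]
theorem khatriRao_apply (B : Matrix m q R) (C : Matrix n q R) (i : m) (j : n) (k : q) :
    khatriRao B C (i, j) k = B i k * C j k := rfl

/-- Entry formula at a pair index.  [cite: KoldaBader2009, §2.6] -/
theorem khatriRao_apply' (B : Matrix m q R) (C : Matrix n q R) (ij : m × n) (k : q) :
    khatriRao B C ij k = B ij.1 k * C ij.2 k := rfl

/-- GVL §12.3.3: the Khatri–Rao product is the submatrix of the Kronecker product `B ⊗ₖ C` on the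
"diagonal" columns `k ↦ (k, k)`.  [cite: GolubVanLoan2013, §12.3.3] -/
theorem khatriRao_eq_submatrix_kronecker (B : Matrix m q R) (C : Matrix n q R) :
    khatriRao B C = (B ⊗ₖ C).submatrix id fun k => (k, k) := rfl

/-- GVL §12.3.3: the Hadamard product is the submatrix of `B ⊗ₖ C` on diagonal rows AND columns.
[cite: GolubVanLoan2013, §12.3.3] -/
theorem hadamard_eq_submatrix_kronecker (B C : Matrix m q R) :
    B ⊙ C = (B ⊗ₖ C).submatrix (fun i => (i, i)) fun k => (k, k) := rfl

/-- The Hadamard product is the row-submatrix `i ↦ (i, i)` of the Khatri–Rao product.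
[cite: GolubVanLoan2013, §12.3.3] [cite: KoldaBader2009, §2.6] -/
theorem hadamard_eq_submatrix_khatriRao (B C : Matrix m q R) :
    B ⊙ C = (khatriRao B C).submatrix (fun i => (i, i)) id := rfl

/-- Column `k` of `B ⊙ C` is `b_k ⊗ c_k`, i.e. (GVL P1.3.7: `y ⊗ x = vec(x yᵀ)`) the column stacking
of the rank-one matrix `b_k c_kᵀ` read with the pair index in the order `(i, j)`.
[cite: GolubVanLoan2013, §12.3.3] [cite: KoldaBader2009, §2.6] -/
theorem khatriRao_col (B : Matrix m q R) (C : Matrix n q R) (k : q) :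
    (khatriRao B C)ᵀ k = vec (vecMulVec (Bᵀ k) (Cᵀ k))ᵀ := rfl

/-- Kolda–Bader: "if `a` and `b` are vectors, then the Khatri–Rao and Kronecker products are
identical" — for one-column matrices `B ⊗ₖ C` is `B ⊙ C` (up to the unique column index).
[cite: KoldaBader2009, §2.6] -/
theorem kronecker_eq_khatriRao_of_unique [Unique q] (B : Matrix m q R) (C : Matrix n q R) :
    B ⊗ₖ C = (khatriRao B C).submatrix id fun _ => default := by
  ext ⟨i, j⟩ ⟨k, k'⟩
  rw [Unique.eq_default k, Unique.eq_default k']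
  rfl

end Def

/-! ## Bilinearity and diagonal scaling -/

section Linear

/-- Additivity in the first factor.  [cite: KoldaBader2009, §2.6] -/
theorem add_khatriRao [Mul R] [Add R] [RightDistribClass R] (B B' : Matrix m q R)
    (C : Matrix n q R) : khatriRao (B + B') C = khatriRao B C + khatriRao B' C := by
  ext ⟨i, j⟩ k
  simp [add_mul]

/-- Additivity in the second factor.  [cite: KoldaBader2009, §2.6] -/
theorem khatriRao_add [Mul R] [Add R] [LeftDistribClass R] (B : Matrix m q R)
    (C C' : Matrix n q R) : khatriRao B (C + C') = khatriRao B C + khatriRao B C' := by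
  ext ⟨i, j⟩ k
  simp [mul_add]

/-- Scalars pull out of the first factor.  [cite: KoldaBader2009, §2.6] -/
theorem smul_khatriRao {S : Type*} [Mul R] [SMul S R] [IsScalarTower S R R] (c : S)
    (B : Matrix m q R) (C : Matrix n q R) : khatriRao (c • B) C = c • khatriRao B C := by
  ext ⟨i, j⟩ k
  simp [smul_mul_assoc]

/-- Scalars pull out of the second factor.  [cite: KoldaBader2009, §2.6] -/
theorem khatriRao_smul {S : Type*} [Mul R] [SMul S R] [SMulCommClass S R R] (c : S)
    (B : Matrix m q R) (C : Matrix n q R) : khatriRao B (c • C) = c • khatriRao B C := by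
  ext ⟨i, j⟩ k
  simp [mul_smul_comm]

/-- `0 ⊙ C = 0`.  [cite: KoldaBader2009, §2.6] -/
@[simp]
theorem zero_khatriRao [MulZeroClass R] (C : Matrix n q R) :
    khatriRao (0 : Matrix m q R) C = 0 := by
  ext ⟨i, j⟩ k
  simp

/-- `B ⊙ 0 = 0`.  [cite: KoldaBader2009, §2.6] -/
@[simp]
theorem khatriRao_zero [MulZeroClass R] (B : Matrix m q R) :
    khatriRao B (0 : Matrix n q R) = 0 := by
  ext ⟨i, j⟩ k
  simp

/-- A diagonal column scaling (the CP weights `diag(λ)`) may be absorbed into the second factor: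
`(B ⊙ C) · diag d = B ⊙ (C · diag d)`.
[cite: GolubVanLoan2013, §12.5.4] [cite: KoldaBader2009, §3] -/
theorem khatriRao_mul_diagonal [NonUnitalSemiring R] [Fintype q] [DecidableEq q]
    (B : Matrix m q R) (C : Matrix n q R) (d : q → R) :
    khatriRao B C * diagonal d = khatriRao B (C * diagonal d) := by
  ext ⟨i, j⟩ k
  simp only [khatriRao_apply, Matrix.mul_diagonal]
  exact mul_assoc _ _ _

/-- … or into the first factor: `(B · diag d) ⊙ C = (B ⊙ C) · diag d` (commutative scalars).
[cite: GolubVanLoan2013, §12.5.4] [cite: KoldaBader2009, §3] -/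
theorem khatriRao_diagonal_mul_left [NonUnitalCommSemiring R] [Fintype q] [DecidableEq q]
    (B : Matrix m q R) (C : Matrix n q R) (d : q → R) :
    khatriRao (B * diagonal d) C = khatriRao B C * diagonal d := by
  ext ⟨i, j⟩ k
  simp only [khatriRao_apply, Matrix.mul_diagonal]
  exact mul_right_comm _ _ _

end Linear

/-! ## Associativity (Kolda–Bader (2.2)) -/

section Assoc

/-- Kolda–Bader (2.2): `A ⊙ B ⊙ C = (A ⊙ B) ⊙ C = A ⊙ (B ⊙ C)` — associativity of the Khatri–Rao
product, up to re-association `Equiv.prodAssoc` of the row index (cf. Mathlib's `kronecker_assoc`).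
[cite: KoldaBader2009, §2.6 (2.2)] -/
theorem khatriRao_assoc [Semigroup R] (A : Matrix l q R) (B : Matrix m q R) (C : Matrix n q R) :
    Matrix.reindex (Equiv.prodAssoc l m n) (Equiv.refl q) (khatriRao (khatriRao A B) C) =
      khatriRao A (khatriRao B C) := by
  ext ⟨i, j, k'⟩ k
  simp [mul_assoc]

end Assoc

/-! ## Gram matrices: `(B ⊙ C)ᵀ (B' ⊙ C') = (BᵀB') ∗ (CᵀC')` -/

section Gram

variable [Fintype m] [Fintype n]

/-- Kolda–Bader (2.2) / GVL (12.5.20) in the two-pair form: `(B ⊙ C)ᵀ (B' ⊙ C')` is the Hadamard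
product of the Gram-type matrices `Bᵀ B'` and `Cᵀ C'`.
[cite: KoldaBader2009, §2.6 (2.2)] [cite: GolubVanLoan2013, §12.5.4 (12.5.20)] -/
theorem khatriRao_transpose_mul_khatriRao [NonUnitalCommSemiring R] (B : Matrix m q R)
    (C : Matrix n q R) (B' : Matrix m p R) (C' : Matrix n p R) :
    (khatriRao B C)ᵀ * khatriRao B' C' = (Bᵀ * B') ⊙ (Cᵀ * C') := by
  ext k k'
  simp only [mul_apply, transpose_apply, hadamard_apply, khatriRao_apply', Fintype.sum_prod_type,
    Finset.sum_mul_sum]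
  exact Finset.sum_congr rfl fun i _ => Finset.sum_congr rfl fun j _ => mul_mul_mul_comm _ _ _ _

/-- Kolda–Bader (2.2): `(A ⊙ B)ᵀ (A ⊙ B) = AᵀA ∗ BᵀB`; equivalently the coefficient matrix
`(BᵀB) .* (CᵀC)` of the ALS normal equations GVL (12.5.20).
[cite: KoldaBader2009, §2.6 (2.2)] [cite: GolubVanLoan2013, §12.5.4 (12.5.20)] -/
theorem khatriRao_transpose_mul_self [NonUnitalCommSemiring R] (B : Matrix m q R)
    (C : Matrix n q R) : (khatriRao B C)ᵀ * khatriRao B C = (Bᵀ * B) ⊙ (Cᵀ * C) :=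
  khatriRao_transpose_mul_khatriRao B C B C

/-- The conjugate-transpose version `(B ⊙ C)ᴴ (B' ⊙ C') = (BᴴB') ∗ (CᴴC')` (complex factors).
[cite: KoldaBader2009, §2.6 (2.2)] -/
theorem khatriRao_conjTranspose_mul_khatriRao [CommSemiring R] [StarRing R]
    (B : Matrix m q R) (C : Matrix n q R) (B' : Matrix m p R) (C' : Matrix n p R) :
    (khatriRao B C)ᴴ * khatriRao B' C' = (Bᴴ * B') ⊙ (Cᴴ * C') := by
  ext k k'
  simp only [mul_apply, conjTranspose_apply, hadamard_apply, khatriRao_apply',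
    Fintype.sum_prod_type, Finset.sum_mul_sum]
  exact Finset.sum_congr rfl fun i _ => Finset.sum_congr rfl fun j _ => by
    rw [star_mul', mul_mul_mul_comm]

end Gram

/-- Swapping the factors of a Khatri–Rao product permutes the rows by `Prod.swap` — the restriction
of the Kronecker commutation rule `P (B ⊗ C) Qᵀ = C ⊗ B` (GVL (1.3.5)) to the columns `(k, k)`.
[cite: GolubVanLoan2013, §12.3.3 with §1.3.6 (1.3.5)] -/
theorem khatriRao_comm [CommMagma R] (B : Matrix m q R) (C : Matrix n q R) :
    khatriRao C B = (khatriRao B C).submatrix Prod.swap id := by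
  ext ⟨j, i⟩ k
  exact mul_comm _ _


/-! ## The mixed product `(A ⊗ A') (B ⊙ C) = (A B) ⊙ (A' C)` -/

section Mixed

variable [Fintype m] [Fintype n]

/-- The Kronecker–Khatri–Rao mixed product: `(A ⊗ₖ A') (B ⊙ C) = (A B) ⊙ (A' C)` — column by
column this is the mixed-product rule `(A ⊗ A')(b_k ⊗ c_k) = (A b_k) ⊗ (A' c_k)` (GVL §1.3.6) for
the columns `b_k ⊗ c_k` of GVL §12.3.3.
[cite: GolubVanLoan2013, §12.3.3 with §1.3.6] [cite: KoldaBader2009, §2.6] -/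
theorem kronecker_mul_khatriRao [NonUnitalCommSemiring R] (A : Matrix l m R) (A' : Matrix p n R)
    (B : Matrix m q R) (C : Matrix n q R) :
    (A ⊗ₖ A') * khatriRao B C = khatriRao (A * B) (A' * C) := by
  ext ⟨i, j⟩ k
  simp only [mul_apply, kronecker_apply, khatriRao_apply', Fintype.sum_prod_type,
    Finset.sum_mul_sum]
  exact Finset.sum_congr rfl fun i' _ => Finset.sum_congr rfl fun j' _ =>
    mul_mul_mul_comm _ _ _ _

end Mixed

/-! ## The ALS normal equations (GVL (12.5.20)) -/

section Normal

variable [Fintype m] [Fintype n] [Fintype q]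

/-- GVL (12.5.20): the normal-equation system of the tall-skinny least-squares problem
`min ‖(B ⊙ C) z − d‖₂` (12.5.19) has the coefficient matrix `(BᵀB) .* (CᵀC)`:
`((BᵀB) ∗ (CᵀC)) z = (B ⊙ C)ᵀ ((B ⊙ C) z)`.
[cite: GolubVanLoan2013, §12.5.4 (12.5.19)-(12.5.20)] [cite: KoldaBader2009, §3.4] -/
theorem hadamard_gram_mulVec [CommSemiring R] (B : Matrix m q R) (C : Matrix n q R)
    (z : q → R) :
    ((Bᵀ * B) ⊙ (Cᵀ * C)) *ᵥ z = (khatriRao B C)ᵀ *ᵥ (khatriRao B C *ᵥ z) := by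
  rw [mulVec_mulVec, khatriRao_transpose_mul_self]

end Normal

/-! ## The CP unfolding `𝓧₍₁₎ = F · diag(λ) · (H ⊙ G)ᵀ` -/

section CP

variable [Fintype q] [DecidableEq q]

/-- GVL §12.5.4 / Kolda–Bader (3.2): for factor matrices `F, G, H` with `q` columns and weights
`λ`, the matrix `F · diag(λ) · (H ⊙ G)ᵀ : Matrix m (p × n) R` has entry
`Σ_r λ_r · F i r · G j r · H k r` at `(i, (k, j))` — it is the mode-1 unfolding of the CP tensor
`Σ_r λ_r f_r ∘ g_r ∘ h_r` (entry `(i, j, k)` placed in row `i`, column `(k, j)`).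
[cite: GolubVanLoan2013, §12.5.4 (before (12.5.16))] [cite: KoldaBader2009, §3 (3.2)] -/
theorem mul_diagonal_mul_khatriRao_transpose_apply [CommSemiring R] (F : Matrix m q R)
    (G : Matrix n q R) (H : Matrix p q R) (lam : q → R) (i : m) (j : n) (k : p) :
    (F * diagonal lam * (khatriRao H G)ᵀ) i (k, j) = ∑ r, lam r * F i r * G j r * H k r := by
  rw [mul_apply]
  simp only [Matrix.mul_diagonal, transpose_apply, khatriRao_apply]
  exact Finset.sum_congr rfl fun r _ => by ring

/-- Kolda–Bader §3, frontal slices `X_k = A D⁽ᵏ⁾ Bᵀ`, `D⁽ᵏ⁾ = diag(c_{k,:})`: fixing the third index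
`k` in the unfolding `F · diag(λ) · (H ⊙ G)ᵀ` gives the matrix `F · diag(λ_r H k r) · Gᵀ`.
[cite: KoldaBader2009, §3 (frontal slices after (3.2))] [cite: GolubVanLoan2013, §12.5.4] -/
theorem cp_frontal_slice [CommSemiring R] (F : Matrix m q R) (G : Matrix n q R)
    (H : Matrix p q R) (lam : q → R) (k : p) :
    (Matrix.of fun i j => (F * diagonal lam * (khatriRao H G)ᵀ) i (k, j)) =
      F * diagonal (fun r => lam r * H k r) * Gᵀ := by
  ext i j
  rw [of_apply, mul_diagonal_mul_khatriRao_transpose_apply, mul_apply]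
  simp only [Matrix.mul_diagonal, transpose_apply]
  exact Finset.sum_congr rfl fun r _ => by ring

/-- The vectorised two-factor case: `(B ⊙ C) d = vec (C · diag d · Bᵀ)` — the weights `d` against
the columns `b_k ⊗ c_k = vec(c_k b_kᵀ)` (GVL §12.3.3, §1.3.7 (1.3.6)).
[cite: GolubVanLoan2013, §12.3.3 with §1.3.7 (1.3.6)] [cite: KoldaBader2009, §3] -/
theorem khatriRao_mulVec [CommSemiring R] (B : Matrix m q R)
    (C : Matrix n q R) (d : q → R) :
    khatriRao B C *ᵥ d = vec (C * diagonal d * Bᵀ) := by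
  funext ⟨i, j⟩
  show ∑ k, B i k * C j k * d k = (C * diagonal d * Bᵀ) j i
  rw [mul_apply]
  simp only [Matrix.mul_diagonal, transpose_apply]
  exact Finset.sum_congr rfl fun k _ => by ring

end CP

end Literature.LinearAlgebra.TensorNetworks
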